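import Summits.BirchSwinnertonDyer.BirchSwinnertonDyer.Theorems.SignedLowerHalvesSmallImageLowerHalfBothSignsRttD2J2DeltaLevel
import Literature.NumberTheory.GaloisCohomology.RestrictedRamificationFiniteCohomologyBaseChange
import Literature.NumberTheory.ComplexMultiplication.EllipticUnits.ImaginaryQuadraticMainConjectureLayerDualityMaps
import HarnessLib

/-!
# Route `SignedLowerHalves`, crux L `SmallImageLowerHalfBothSigns` (stmt-BirchSwinnertonDyer-23599), line `rtt_w3` v29 — row **S3α**, brick **α1**, INJECTIVITY HALF,
# brick (i-c): THE LEVEL GROUPS `Hⁱ(G_P(F), (𝒪 ⊗ μ_{p^k} ⊗ θ)^{N_P})` ARE FINITE IN EVERY DEGREE (NSW (8.3.20), a THEOREM of the tree)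

INPUTS hand `bsd-inputs-honda-p1` g27 under LEAD `cruxlead-stmt-BirchSwinnertonDyer-23599` g13. Helper `--supports stmt-BirchSwinnertonDyer-23599`. THEOREMS ONLY.
The degree-`1` case is -w3's `SmallImageRttD2Seq.finite_levelCohO_one` (Serre III §4.1 Prop. 8, type (F)); the all-degree statement needs `P ⊇ {v ∣ p}` and is
NSW (8.3.20) / Harari Cor. 17.17, PROVED in the tree at every number field (`finite_restrictedCohomology_holds`, `GaloisCohomology/RestrictedRamificationFiniteCohomologyBaseChange`):
* `isPGroup_coeffGSO_fun`, `mem_of_natCard_mem` — `Maps(G_P ⧸ U_P, X_k)` is a `p`-group, so every place dividing its order lies over `p`;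
* ★★ `finite_levelCohO` — `Finite (levelCohO S P θ U k i)` for `P` finite containing the places above `p`, `U` open, every `k i` (Shapiro
  `finite_continuousCohomology_coindOpen_iff` + `finite_continuousCohomology_of_baseChange` at the cyclotomic layer `K(ζ_{p²}) ⊆ K_P` + `finite_restrictedCohomology_holds`);
  `finite_layerCohO`, `finite_cycLayerCohO` — the pair layers / `κ`-layers at `P = supp(p𝔣)` (`𝔣 ≠ ⊥`): the hypothesis `hfin` of brick (i-b) `…Sp2Injective`.
HONEST FRAMING: S3α, crux L and BSD remain OPEN; BSD is proved for NO curve.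

References: [NeukirchSchmidtWingberg2008] (8.3.20); [Harari2020] Cor. 17.17; [MilneADT2006] I Cor. 4.15; [SerreGaloisCohomology1997] I §2.5 Prop. 10; [JohnsonLeungKings2011] §4.2 Def. 4.2 (94).
-/

set_option autoImplicit false
-- the Theorems namespace of this sub repeats the summit name by design (D-0017 nested layout)
set_option linter.dupNamespace false

noncomputable section

open scoped NumberField
open Field IsDedekindDomain NumberField
open Literature.NumberTheory.GaloisRepresentations
open Literature.NumberTheory.GaloisCohomology
open Literature.NumberTheory.EllipticCurves
open Literature.NumberTheory.ComplexMultiplication.EllipticUnits.JohnsonLeungKings2011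
open Summit.BirchSwinnertonDyer.BirchSwinnertonDyer.Theorems.SmallImageRttD2J2Delta

namespace Summit.BirchSwinnertonDyer.BirchSwinnertonDyer.Theorems.SmallImageRttJunctionSha

variable {K : Type} [Field K] [NumberField K] {p : ℕ} [Fact p.Prime] (S : Set (PadicAlgCl p)) [FiniteDimensional ℚ_[p] (padicCoeffField S)]
  (P : Set (HeightOneSpectrum (𝓞 K))) (θ : absoluteGaloisGroup K →ₜ* (padicCoeffIntegers S)ˣ)

omit [NumberField K] [FiniteDimensional ℚ_[p] (padicCoeffField S)] in
/-- `Maps(Q, X_k)` is a `p`-group (`p^k` kills `X_k = (𝒪 ⊗ μ_{p^k} ⊗ θ)^{N_P}`, `coeffGSO_torsion`). [cite: JohnsonLeungKings2011, §4.2 Def. 4.2 (arXiv p0012:L80–95)] -/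
theorem isPGroup_coeffGSO_fun (k : ℕ) (Q : Type) : IsPGroup p (Multiplicative (Q → (coeffGSO S P θ k).toTopRep)) := fun g ↦
  ⟨k, by
    rw [← ofAdd_toAdd g, ← ofAdd_nsmul, ofAdd_eq_one]
    funext q
    rw [Pi.smul_apply, Pi.zero_apply, ← natCast_zsmul, Nat.cast_pow]
    exact coeffGSO_torsion S P θ k _⟩

omit [NumberField K] [FiniteDimensional ℚ_[p] (padicCoeffField S)] in
/-- A place dividing the order of a finite `p`-group lies over `p`. [cite: NeukirchSchmidtWingberg2008, (8.3.20)] -/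
theorem mem_of_natCard_mem {A : Type} [AddCommGroup A] [Finite A] (hA : IsPGroup p (Multiplicative A)) (v : HeightOneSpectrum (𝓞 K))
    (hv : ((Nat.card A : ℕ) : 𝓞 K) ∈ v.asIdeal) : ((p : ℕ) : 𝓞 K) ∈ v.asIdeal := by
  obtain ⟨n, hn⟩ := IsPGroup.iff_card.mp hA
  change Nat.card A = p ^ n at hn
  rw [hn, Nat.cast_pow] at hv
  rcases Nat.eq_zero_or_pos n with h0 | _
  · rw [h0, pow_zero] at hv
    exact absurd ((Ideal.eq_top_iff_one _).2 hv) v.isPrime.ne_top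
  · exact v.isPrime.mem_of_pow_mem n hv

/-- ★★ **`Hⁱ(G_P(F), (𝒪 ⊗ μ_{p^k} ⊗ θ)^{N_P})` is finite** for `P` finite containing every place above `p`, `F = K̄^U` with `U` open, EVERY `i` and `k` — NSW (8.3.20) at the
totally complex cyclotomic layer `K(ζ_{p²}) ⊆ K_P` (`finite_restrictedCohomology_holds`), base-changed (`finite_continuousCohomology_of_baseChange`) to the finite `G_P`-module
`Maps(G_P ⧸ U_P, X_k)` and read through Shapiro (`finite_continuousCohomology_coindOpen_iff`). [cite: NeukirchSchmidtWingberg2008, (8.3.20)] [cite: Harari2020, Cor. 17.17]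
[cite: SerreGaloisCohomology1997, I §2.5 Prop. 10] -/
theorem finite_levelCohO (hP : P.Finite) (hPp : ∀ v : HeightOneSpectrum (𝓞 K), ((p : ℕ) : 𝓞 K) ∈ v.asIdeal → v ∈ P)
    {U : Subgroup (absoluteGaloisGroup K)} (hU : IsOpen (U : Set (absoluteGaloisGroup K))) (k i : ℕ) : Finite (levelCohO S P θ U k i) := by
  classical
  haveI : TotallyDisconnectedSpace (GaloisGroupUnramifiedOutside K P) := totallyDisconnectedSpace_GS P
  haveI := finite_coeffGSO P S θ k
  have hUo : IsOpen (imGS P U : Set (GaloisGroupUnramifiedOutside K P)) := isOpen_imGS_of_isOpen P hU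
  refine ((coeffGSO S P θ k).finite_continuousCohomology_coindOpen_iff (imGS P U) hUo i).mp ?_
  -- the cyclotomic layer `L = K(ζ_{p²})` inside `K_P`
  let L := CyclotomicField (p ^ 2) K
  have hKS : ramificationSubgroup K P ≤ (absGaloisRestrict K L).range := ramificationSubgroup_le_range_absGaloisRestrict_cyclotomicField hPp 2
  haveI : Finite (GaloisGroupUnramifiedOutside K P ⧸ imGS P U → (coeffGSO S P θ k).toTopRep) := ContinuousRep.finite_coindOpen (imGS P U) hUo
  exact finite_continuousCohomology_of_baseChange L hP hKS (finite_restrictedCohomology_holds L) _ ((coeffGSO S P θ k).coindOpen (imGS P U) hUo)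
    (fun v hv ↦ hPp v (mem_of_natCard_mem (isPGroup_coeffGSO_fun S P θ k _) v hv)) i

variable (κ₁ κ₂ : ZpExtension K p) (𝔣 : Ideal (𝓞 K))

/-- ★ **The pair-layer groups `Hⁱ(G_S(K̃_n), X_k)` are finite** (`S = supp(p𝔣)` finite) — the hypothesis `hfin` of brick (i-b). [cite: NeukirchSchmidtWingberg2008, (8.3.20)] -/
theorem finite_layerCohO (hP : (suppPF p 𝔣).Finite) (n k i : ℕ) : Finite (layerCohO S κ₁ κ₂ θ 𝔣 n k i) :=
  finite_levelCohO S (suppPF p 𝔣) θ hP (ClassGroupRow.mem_suppPF_of_mem p 𝔣) (isOpen_pairLayerSubgroup κ₁ κ₂ n) k i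

/-- ★ **The `κ`-layer groups `Hⁱ(G_S(K_n), X_k)` are finite** (`S = supp(p𝔣)` finite). [cite: NeukirchSchmidtWingberg2008, (8.3.20)] -/
theorem finite_cycLayerCohO (κ : ZpExtension K p) (hP : (suppPF p 𝔣).Finite) (n k i : ℕ) :
    Finite (SmallImageRttD2J1.cycLayerCohO S κ θ (suppPF p 𝔣) n k i) :=
  finite_levelCohO S (suppPF p 𝔣) θ hP (ClassGroupRow.mem_suppPF_of_mem p 𝔣) (κ.isOpen_layerSubgroup n) k i

end Summit.BirchSwinnertonDyer.BirchSwinnertonDyer.Theorems.SmallImageRttJunctionSha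

end
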